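import Summits.CriticalPhenomena.PercolationContinuityZ3.Theses.PercNonProliferation
import Summits.CriticalPhenomena.PercolationContinuityZ3.Theorems.FreeBoxPowerSaving.Negative.FreeBoxPowerSavingBounds
import HarnessLib.Audit
import Summits.CriticalPhenomena.PercolationContinuityZ3.Theorems.PercNonProliferationFreeBoxPowerSavingSizeSplitting
import Summits.CriticalPhenomena.PercolationContinuityZ3.Theorems.PercNonProliferationFreeBoxPowerSavingLogBoost
import Summits.CriticalPhenomena.PercolationContinuityZ3.Theorems.PercNonProliferationFreeBoxPowerSavingShatteringBoost
import Summits.CriticalPhenomena.PercolationContinuityZ3.Theorems.PercNonProliferationFreeBoxPowerSavingMultiSplitting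
import Summits.CriticalPhenomena.PercolationContinuityZ3.Theorems.FreeBoxPowerSaving.Negative.FreeBoxPowerSavingQuasiGiant
import Literature.Probability.Percolation.SeedLemma
import Summits.CriticalPhenomena.PercolationContinuityZ3.Theorems.PercNonProliferationFreeBoxPowerSavingBoundaryInteriorSplit
import Summits.CriticalPhenomena.PercolationContinuityZ3.Theorems.PercNonProliferationFreeBoxPowerSavingConfinedQuasiGiants
import Summits.CriticalPhenomena.PercolationContinuityZ3.Theorems.PercNonProliferationFreeBoxPowerSavingBdryQuasiGiantLeWall

/-!
# Line `boundary-interior-split-fat-finite-clusters` — skeleton for crux `FreeBoxPowerSaving`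
# (stmt-CriticalPhenomena-4447, route `PercNonProliferation`, r5)

RESHAPE v3 BY THE LEAD (gen 1 continuation `prover-line-stmt-CriticalPhenomena-4447-c2-0`, 2026-08-16):
registered stubs (3): `stub_confinedQuasiGiantsVanish` (I₁, open, stub-blocked on stmt-5786 by wave 3),
`stub_boundaryQuasiGiantsNotAS` (B, open, one-bit, lead-held), and the NEW transport stub
`stub_bdryQuasiGiant_le_wall` (every `p`: `P_p(BQG_n(s)) ≤ 6(2n+1)² P_p(s ≤ #{y ∈ Λ_{2n} : 0 ↔_ℍ y})`,
lattice-symmetry transport to the floor-rooted half-space cluster `U = C_ℍ(0)` — LANDED p105790 (worker w-wall)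
and now used BY NAME, so the registered open stubs are again exactly (I₁) and (B)).
New sorry-free glue: ROUTE W — `boundaryQuasiGiantsNotAS_of_fatWallFeetSparse` ((B) from "fat wall
clusters have few feet in expectation", a statement about the single object `U` of routes
PercLowPointHalfSpace / PercBoundarySqueeze) with the exchange rate `fatWallFeetSparse_of_volumeTail`
(a volume tail `P(t ≤ |U ∩ Λ_r|) ≤ C r^{km}/t^k` with `k(3-m) > 4` suffices; `k = 1` never does — the
first-moment route to (B) is dead at EVERY wall-mass exponent); ROUTE F —
`confinedQuasiGiantsVanish_of_finiteClusterTail` ((I₁) from ANY power-law upper tail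
`P_{p_c}(s ≤ |C(0)| < ∞) ≤ C s^{-c₀}` of the finite critical cluster volume, over the landed first-moment
reduction p99710).  Neither route's hypothesis is in the tree or in print for `d = 3`.

RESHAPE v2 BY THE LEAD (gen 1, after wave 1, 2026-08-16T14:05Z): registered stubs are now
`stub_confinedQuasiGiantsVanish` (I₁, the weakest crux-necessary interior form) and
`stub_boundaryQuasiGiantsNotAS` (B).  Landed and wired BY NAME: `stub_boundaryInteriorSplit` (p96838,
worker w1), the shattering boosts (p96610; sharp form p97460 — `FreeBoxPowerSaving_of_polyRareShattering`,
`crux_iff_polyRareShattering`), the conditional `stub_fatFiniteClusters_of_freeSusceptibilityPowerSaving`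
(p96861, worker w2: stmt-5786 ⟹ (I); the stub (I) itself is `stub-blocked` on stmt-5786 and is kept
below as a SUFFICIENT statement, `FreeBoxPowerSaving_of_fatFiniteClusters`).  Kernel-checked:
`split₀` (`quasiGiant_subset_union`), `crux_iff_parts` (crux ⟺ (I₁) ∧ (B)), `intQuasiGiant_real_le`
((I) ⟹ (I₁) via first moment + translation), `crux_iff_polyRareShattering`.

RESHAPE v1 BY THE LEAD (prover-line-stmt-CriticalPhenomena-4447-1, gen 1, 2026-08-16T10:35Z): the two stubs shared
verbatim with the sibling line have LANDED through the gate and are used below BY NAME —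
`stub_sizeSplitting` := `FreeBoxPowerSavingLine.stub_sizeSplitting` (p77722,
`Theorems/PercNonProliferationFreeBoxPowerSavingSizeSplitting.lean`) and `stub_logBoost` :=
`FreeBoxPowerSavingLine.stub_logBoost` (p79965, `…LogBoost.lean`).  Registered stubs now (3):
`stub_boundaryInteriorSplit` (provable, M; delegated), `stub_fatFiniteClusters` ((I), open), and
`stub_boundaryQuasiGiantsNotAS` ((B), open, hardest — held by the lead).  Converses already landed:
crux ⟹ (I) (`FreeBoxPowerSavingNegative.fatFiniteClusters_of_freeBoxPowerSaving`, p81639) and crux ⟹ (B)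
(`FreeBoxPowerSavingNegative.boundaryQuasiGiantsNotAS_of_freeBoxPowerSaving`, p81641), so once the split
lands the transfer crux ⟺ (I) ∧ (B) is kernel-checked in both directions.

Crux (by name, `Summit.CriticalPhenomena.PercolationContinuityZ3.Theses.PercNonProliferation.FreeBoxPowerSaving`):
`∃ a C, 0 < a ∧ ∀ n ≥ 1, FA₂(p_c, n) ≤ C n^{-a}`, where
`FA₂(p, n) = |Λ_n|⁻² Σ_{x,y ∈ Λ_n} P_p(x ↔ y inside Λ_n)`, `Λ_n = box 3 n = [-n,n]³`, bond percolation
on `ℤ³`, `p_c = criticalProbI 3`.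

THE LINE (idea card `Ideas/boundary-interior-split-fat-finite-clusters.md`, sharpened by the r1
triage panel `TRIAGE-r1-{1,2,3}.md`).  Write `N_n(u, ω) = #{v ∈ Λ_n : u ↔ v inside Λ_n}` for the
size of the in-box piece of `u`, `QG_n(s) = {∃ u ∈ Λ_n, N_n(u) ≥ s}` ("some in-box piece has `≥ s`
vertices", i.e. `|K_max^free(Λ_n)| ≥ s`) and `BQG_n(s) = {∃ u ∈ ∂ⁱⁿΛ_n, N_n(u) ≥ s}` ("some piece
TOUCHING THE INNER VERTEX BOUNDARY has `≥ s` vertices").  The free boundary splits the in-box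
pieces EXACTLY into boundary-touching pieces and interior pieces, and on the full-measure event
`ω ⊆ E(ℤ³)` an interior piece IS a full (finite) `ℤ³`-cluster confined to `Λ_n ⊆ v + Λ_{2n}`.
Hence (one-bit currency of the sibling card `tightness-collapse-typical-kmax`, as all three triagers
asked):

* `stub_boundaryInteriorSplit` (the split + two Markov inequalities + translation invariance;
  every `p`; provable now, size M):
  `P_p(QG_n(s)) ≤ P_p(BQG_n(s)) + |Λ_n| · E_p[|C(0)| ; C(0) ⊆ Λ_{2n}] / s²`  (`s > 0`).
* `stub_fatFiniteClusters` = the card's (I) `FatFiniteClusterBound`, verbatim (triage r1-2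
  sharpening): `E_{p_c}[|C(0)| ; C(0) ⊆ Λ_{2n}] ≤ C n^{3-a}` for some `a > 0` — a JUMP-FREE statement
  about FINITE critical clusters ("confined clusters are not fat"), strictly weaker than bulk ball
  decay (PercTwoPointDecay's `X_A`), implied by the crux (Disproof §6), located nowhere in print for
  `d = 3`.  The line's distinctive bet; open, size L–XL.
* `stub_boundaryQuasiGiantsNotAS` = the card's (B) in constant-probability form
  `BoundaryQuasiGiantNotAS(a, ε)` (triage r1-1/2/3: drop the depth-profile RATE sub-route, which is
  summit-strength): eventually `P_{p_c}(BQG_n(n^{3-a})) ≤ 1 - ε`.  ALL jump-world (monolithic-branch)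
  content of the crux sits here; the criticality of the parameter is used here (false at `p = 1`).
  HARDEST stub (crux-hard; no mechanism beyond BGN-type half-space/orthant arguments yet).
* `stub_sizeSplitting` (the square-root trick = `k = 1` of Hutchcroft's BK size-multiplicativity,
  arXiv:2008.11197 Thm 2.3, re-derived elementarily by triage r1-2 App. A: spanning-tree peeling into
  two edge-disjoint open subtrees + `bk_finitary_list`; every `p`; provable now, size M):
  `P_p(QG_n(3s)) ≤ P_p(QG_n(s))²` for real `s ≥ 1`.
* `stub_logBoost` (the tightness collapse, card 1's `FirstLemma1` with the square-root trick as its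
  hypothesis; real analysis, provable now, size M): size-splitting + "`QG_n(n^{3-a})` has probability
  `≤ 1 - ε` eventually" ⟹ an eventual power saving `FA₂(p, n) ≤ C n^{-a'}` (iterate to
  `P(QG_n(3^k s)) ≤ (1-ε)^{2^k}`, `2^k ≍ log n`, `3^k = polylog(n)`, and
  `Σ_{x,y} P(x ↔ y in Λ_n) = E Σ_u N_n(u) ≤ |Λ_n| · E max_u N_n(u) ≤ |Λ_n| (3^k s + |Λ_n| n^{-7})`).
* `line_composition` (kernel-checked, no `sorry`; hypotheses = the five stub statements verbatim up
  to the set abbreviations `quasiGiant` / `bdryQuasiGiant` / `confinedVol`, definitionally equal to the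
  stub types): with `a := min a_B (a_I/4)` the split gives
  `P(QG_n(n^{3-a})) ≤ P(BQG_n(n^{3-a_B})) + 27 C_I n^{2a - a_I} ≤ 1 - ε/2` eventually, the boost gives an
  eventual power saving at `p_c`, and the landed normal form
  `FreeBoxPowerSavingNegative.of_eventually` (Theorems/FreeBoxPowerSaving/Negative/, p73056) upgrades
  it to all `n ≥ 1`; `FreeBoxPowerSaving_of` applies it to the stubs and concludes the crux BY NAME.

Disproof.lean (cdisprove v9, 2026-08-16T02:15Z, NO KILL) honoured — no `_false_without_<H>` theorem
with a named hypothesis exists; the load-bearing analyses are answered as follows: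
`not_powerSavingAt_one` / `Negative.false_at_one` (p = p_c is load-bearing): stubs 1, 4, 5 hold at
EVERY `p` and stub 2 holds at `p = 1` vacuously (`C(0) = ℤ³` is never confined), so the whole
`p`-dependence sits in `stub_boundaryQuasiGiantsNotAS`, which is FALSE at `p = 1` (the box is one
piece touching `∂ⁱⁿΛ_n`) — "the line uses H := (p = p_c) at stub 3"; `false_without_guard`: the
conclusion keeps `1 ≤ n` (crux verbatim) and stubs 2–3–5 are eventual / guarded; `exponent_le_two`
(any witness has `a ≤ 2`): the line's exponent is `≤ min(a_B, a_I/4)/2`, far below; §6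
`freeBoxPowerSaving_iff_centreRooted`: stub 2 is implied by the crux (`E[|C(0)|; C(0) ⊆ Λ_{2n}] ≤
centreVol(2n)`), so the transfer loses nothing; §9 audit: `FirstLemma2/3` "VALID reductions",
`¬FatFiniteClusterBound a` only for `a > 3` (harmless under `∃ a`).  Landed Negative lemmas imported
and checked against: `Negative/FreeBoxPowerSavingBounds.lean` (used: `of_eventually`, `fa2`);
`Negative/FreeBoxPowerSavingProfile.lean` (subcritical exponent 3: consistent — below `p_c` stub 3
holds with `ε` close to `1`).  Negatives index (8 entries): none concerns free-box connectivities;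
the `R = 0` / `p = 1` junk-parameter lesson of `PercQuarantineIslands.QuarantineInequality_refuted` was
applied to every stub (all hold at `n = 0`, `p ∈ {0,1}`, `s` non-integer).
-/

noncomputable section

open MeasureTheory Filter Topology
open scoped Classical
open Literature.Probability.Percolation Literature.Probability.LatticeModels
open Summit.CriticalPhenomena.PercolationContinuityZ3.FreeBoxPowerSavingNegative (fa2 pairSum
  of_eventually card_box_real card_box_pos)

namespace Summit.CriticalPhenomena.PercolationContinuityZ3.Cruxes.FreeBoxPowerSaving.BoundaryInteriorSplitFatFiniteClusters

/-! ## Registered stubs (statements over tree declarations only; `sorry` lives only here) -/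

/-- **stub_boundaryInteriorSplit (the boundary/interior split in one-bit form; every `p`; LANDED
p96838, `FreeBoxPowerSavingLine.stub_boundaryInteriorSplit`, used here by name).**  For `s > 0`:
`P_p(some in-box piece of Λ_n has ≥ s vertices)
   ≤ P_p(some piece touching ∂ⁱⁿΛ_n has ≥ s vertices) + |Λ_n| · (Σ_{y ∈ Λ_{2n}} P_p(0 ↔ y, C(0) ⊆ Λ_{2n})) / s²`.
Proof route (idea card §Lever/(I), triage-verified): an in-box piece either touches `∂ⁱⁿΛ_n` or is
interior; on the full-measure event `ω ⊆ E(ℤ³)` (`ProbabilityTheory.setBernoulli_ae_subset`) an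
interior piece `P ∋ v` equals the full cluster `C(v)` (an open edge leaving `P` is a lattice edge, so
its far endpoint is either in `Λ_n` — then in `P` — or outside — then its near endpoint is in
`∂ⁱⁿΛ_n`), and `C(v) ⊆ Λ_n ⊆ v + Λ_{2n}`; so on the interior event `Σ_{v ∈ Λ_n} 1{|C(v)| ≥ s, C(v) ⊆
v + Λ_{2n}} ≥ |P| ≥ s` (first Markov), each summand has probability `P_p(|C(0) ∩ Λ_{2n}| ≥ s, C(0) ⊆
Λ_{2n})` by translation invariance (`bondPercolation_real_preimage_shift`), which is
`≤ E_p[|C(0) ∩ Λ_{2n}| ; C(0) ⊆ Λ_{2n}] / s` (second Markov) `= (Σ_{y ∈ Λ_{2n}} P_p(0 ↔ y, C(0) ⊆ Λ_{2n}))/s`.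
Degenerate checks: `n = 0` (`∂ⁱⁿΛ_0 = Λ_0 = {0}`), `p = 1` (one piece, touching the boundary; confined
volume `0`), `p = 0`, `s > |Λ_n|` (both quasi-giant events empty) — all fine. -/
theorem stub_boundaryInteriorSplit :
    ∀ (p : unitInterval) (n : ℕ) (s : ℝ), 0 < s →
      (bondPercolation (zdGraph 3) p).real
          {ω | ∃ u ∈ box 3 n,
            s ≤ (((box 3 n).filter fun v => ω ∈ openConnIn ↑(box 3 n) u v).card : ℝ)}
        ≤ (bondPercolation (zdGraph 3) p).real
            {ω | ∃ u ∈ innerBoundary (zdGraph 3) (box 3 n),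
              s ≤ (((box 3 n).filter fun v => ω ∈ openConnIn ↑(box 3 n) u v).card : ℝ)}
          + ((box 3 n).card : ℝ) *
              (∑ y ∈ box 3 (2 * n), (bondPercolation (zdGraph 3) p).real
                (openConn 0 y ∩ {ω | openCluster ω 0 ⊆ ↑(box 3 (2 * n))})) / s ^ 2 :=
  Summit.CriticalPhenomena.PercolationContinuityZ3.FreeBoxPowerSavingLine.stub_boundaryInteriorSplit

/-- **stub_confinedQuasiGiantsVanish ((I₁): confined quasi-giants vanish; OPEN — the line's
interior stub in its WEAKEST crux-necessary form, lead reshape gen 1).**  For some `a > 0`,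
`P_{p_c}(some in-box piece of Λ_n AVOIDING ∂ⁱⁿΛ_n has ≥ n^{3-a} vertices) → 0`.  A piece avoiding the
inner vertex boundary is (a.s.) a full finite `ℤ³`-cluster confined to the interior of the box, so
this is a statement about FINITE critical clusters only (no jump content: in a `θ(p_c) > 0` world it
constrains only the finite clusters; true at `p = 1` vacuously; true below `p_c`).  It is exactly
what the composition consumes (`QG ⊆ BQG ∪ IQG`, `split₀` below, no Markov inequality), it is
implied by the crux (`confinedQuasiGiantsVanish_of_crux` below: `IQG ⊆ QG` and the landed
`quasiGiant_tendsto_zero_of_freeBoxPowerSaving`, p81641), and it is implied by the planner's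
expectation form (I) `E_{p_c}[|C(0)|; C(0) ⊆ Λ_{2n}] ≤ C n^{3-a_I}` through the first-Markov /
translation step of `stub_boundaryInteriorSplit` (`P(IQG_n(s)) ≤ |Λ_n| CV(2n)/s²`, any `a < a_I/4`).
Orthodox prediction: interior pieces live on the scale `n^{d_f} = n^{2.52}` (kit j010718:
`E K_max^int ≍ L^{2.55}`, `P(K_max^int ≥ L^{3-a}) = 0.00` for all `a ≤ 0.8` at `L ≤ 97`), so any
`a < 0.48` should do.  No mechanism with a rate for finite critical clusters is known in `d = 3`
(triage r1-2/3); the one-bit currency does not help here because `IQG` is not monotone (attaching an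
interior piece to the wall destroys it), so FKG/square-root tricks do not apply to it. -/
theorem stub_confinedQuasiGiantsVanish :
    ∃ a : ℝ, 0 < a ∧ Tendsto (fun n : ℕ =>
      (bondPercolation (zdGraph 3) (criticalProbI 3)).real
          {ω | ∃ u ∈ box 3 n,
            (∀ w ∈ innerBoundary (zdGraph 3) (box 3 n), ω ∉ openConnIn ↑(box 3 n) u w) ∧
            (n : ℝ) ^ (3 - a) ≤
              (((box 3 n).filter fun v => ω ∈ openConnIn ↑(box 3 n) u v).card : ℝ)}) atTop (𝓝 0) := by
  sorry

/-! ### (B) `stub_boundaryQuasiGiantsNotAS` ((B) in one-bit form, `BoundaryQuasiGiantNotAS(a, ε)`;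
crux-hard).  For some `a, ε > 0`, eventually in `n`: with probability at least
`ε` NO in-box piece of `Λ_n` touching `∂ⁱⁿΛ_n` has `≥ n^{3-a}` vertices.  All jump-world content of the
crux is here (an in-box piece of an infinite cluster touches `∂ⁱⁿΛ_n`, since an infinite open path
leaves the box), and so is the criticality of the parameter (FALSE at `p = 1`, where the whole box is
one boundary-touching piece — matching `Negative.false_at_one`; true below `p_c`).  In the orthodox
picture `|K_max^free| ≍ n^{d_f} = n^{2.52}` so it holds with probability `→ 1` for every `a < 0.477`; it
fails exactly in the MONOLITHIC jump branch (free-box giants), the branch route PercFiniteBoxLRO owns.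
Why one-bit and not a rate (triage r1-1/2/3): by `stub_sizeSplitting` + `stub_logBoost` a probability
`≤ 1 - ε` per scale is as good as a power saving, and the card's cheap footprint/depth-profile bound
needs `Σ_{h ≤ 2n} g_h ≤ n^{1-a-ε}` with `g_h ↓ θ(p_c)`, i.e. continuity WITH a rate (summit-strength) —
deliberately NOT a stub.  Arena: boundary-touching pieces hang from a face inside that face's
half-space (or an edge's quarter-space / a corner's orthant), where Barsky–Grimmett–Newman same-`p`
dynamic renormalisation is a theorem (`BarskyGrimmettNewman1991_Z3_holds`; Grimmett 1999 Thm 7.35, §7.5);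
consumable inputs: `PercLowPointHalfSpace.QuantitativeBGN` (stmt-0913), `.TallClusterMassBound`
(stmt-0912).  Residual named by the card: fat pieces with FEW feet ("pinned"); see the line card.

RESHAPE v3 (lead gen 1 continuation c2, 2026-08-16): (B) stays the registered open boundary stub (its
one-bit form is the weakest crux-necessary one and is numerically robust: `P_{p_c}(BQG_n(n^{3-a})) ≤ 0.93`
already at the threshold exponent `a = 3 - d_f`, Disproof §11.6); NEW is the registered transport stub
`stub_bdryQuasiGiant_le_wall` (every `p`, provable now, delegated) and ROUTE W below
(`boundaryQuasiGiantsNotAS_of_fatWallFeetSparse`, `fatWallFeetSparse_of_volumeTail`): (B) follows from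
"fat wall clusters have few feet in expectation", a statement about the single floor-rooted half-space
cluster `U = C_ℍ(0)`, with a kernel-checked exchange rate to volume-tail / moment bounds for `U`.  Route W
is SUFFICIENT, not registered: it is stronger than (B) by the factor `|∂ⁱⁿΛ_n| ≍ n²` of the union bound
(numerically a fat wall-hung piece has `≍ n^{1.09}` feet, kit j010718, so the expected number of fat feet
is `≍ n^{1.09} · P(fat wall piece)`, `≫ 1` at every accessible scale; it is `≤ 1 - ε` only asymptotically,
in the large-deviation regime `n^{3-a} ≫ n^{d_f}`). -/

/-- **stub_boundaryQuasiGiantsNotAS ((B), registered, OPEN, crux-hard — the HARDEST stub; see the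
section docstring above).**  For some `a, ε > 0`, eventually in `n`: with probability at least `ε` NO
in-box piece of `Λ_n` touching `∂ⁱⁿΛ_n` has `≥ n^{3-a}` vertices. -/
theorem stub_boundaryQuasiGiantsNotAS :
    ∃ a ε : ℝ, 0 < a ∧ 0 < ε ∧ ∀ᶠ n : ℕ in atTop,
      (bondPercolation (zdGraph 3) (criticalProbI 3)).real
          {ω | ∃ u ∈ innerBoundary (zdGraph 3) (box 3 n),
            (n : ℝ) ^ (3 - a) ≤
              (((box 3 n).filter fun v => ω ∈ openConnIn ↑(box 3 n) u v).card : ℝ)}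
        ≤ 1 - ε := by
  sorry

/-! ### Route W (sufficient, kernel-checked glue): the wall form of (B) -/

/-- **stub_bdryQuasiGiant_le_wall (boundary quasi-giants are controlled by the floor-rooted
half-space cluster; every `p`, every `n`, every real `s`; LANDED p105790 by worker w-wall of this seat,
`FreeBoxPowerSavingLine.stub_bdryQuasiGiant_le_wall`, `Theorems/PercNonProliferationFreeBoxPowerSavingBdryQuasiGiantLeWall.lean`,
used here by name; lattice-symmetry bookkeeping as in `percBoundarySqueeze_real_boundary_core_le`).**
`P_p(some piece of Λ_n touching ∂ⁱⁿΛ_n has ≥ s vertices)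
   ≤ 6 (2n+1)² · P_p(s ≤ #{y ∈ Λ_{2n} : 0 ↔ y inside ℍ})`, `ℍ = {x | 0 ≤ x₀}`.
Proof route: union bound over `v ∈ ∂ⁱⁿΛ_n` (`|∂ⁱⁿΛ_n| ≤ 6(2n+1)²`,
`percBoundarySqueeze_card_innerBoundary_box_three_le`); for `v` on the face `{x_i = ±n}`
(`exists_eq_of_mem_innerBoundary_box`) the lattice automorphism `ψ = σ ∘ (· - v)` (`zdShiftIso`,
`zdSignedPermIso`, `σ` the signed coordinate permutation exchanging axes `i` and `0` with sign `∓`)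
maps `v ↦ 0` and `Λ_n` into `ℍ ∩ Λ_{2n}` (`Λ_n - v ⊆ Λ_{2n}`, signed permutations preserve `Λ_{2n}`);
the `Λ_n`-piece of `v` is carried injectively into `{y ∈ Λ_{2n} : 0 ↔ y inside ψ(Λ_n)} ⊆
{y ∈ Λ_{2n} : 0 ↔ y inside ℍ}` (`relabel_mem_openConnIn`, `openConnIn_mono`), so
`{s ≤ |piece_n(v)|} ⊆ relabel(ψ)⁻¹' {s ≤ #{y ∈ Λ_{2n} : 0 ↔_ℍ y}}`, and `P_p` is `ψ`-invariant
(`bondPercolation_real_preimage_relabel_iso`).  Degenerate parameters (`n = 0`, `s ≤ 0`, `p ∈ {0,1}`)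
are uniform: at `p = 1` both probabilities are `1` for `s ≤ |Λ_n|` (then `#{y ∈ Λ_{2n} : 0 ↔_ℍ y} =
|Λ_{2n} ∩ ℍ| ≥ |Λ_n|`). -/
theorem stub_bdryQuasiGiant_le_wall :
    ∀ (p : unitInterval) (n : ℕ) (s : ℝ),
      (bondPercolation (zdGraph 3) p).real
          {ω | ∃ u ∈ innerBoundary (zdGraph 3) (box 3 n),
            s ≤ (((box 3 n).filter fun v => ω ∈ openConnIn ↑(box 3 n) u v).card : ℝ)}
        ≤ 6 * (2 * (n : ℝ) + 1) ^ 2 *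
          (bondPercolation (zdGraph 3) p).real
            {ω | s ≤ (((box 3 (2 * n)).filter fun y =>
              ω ∈ openConnIn {x : Site 3 | 0 ≤ x 0} (0 : Site 3) y).card : ℝ)} :=
  Summit.CriticalPhenomena.PercolationContinuityZ3.FreeBoxPowerSavingLine.stub_bdryQuasiGiant_le_wall

/-- **Route W: (B) from "fat wall clusters have few feet in expectation" (sorry-free glue over the
transport stub).**  HYPOTHESIS `FatWallFeetSparse(a, ε)`: for some `a, ε > 0`, eventually in `n`,
`6 (2n+1)² · P_{p_c}(n^{3-a} ≤ #{y ∈ Λ_{2n} : 0 ↔ y inside ℍ}) ≤ 1 - ε`,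
i.e. the expected number of sites `w ∈ ∂ⁱⁿΛ_n` whose WALL CLUSTER `C_{ℍ(w)}(w)` (the cluster of the
floor point `w` in the closed half-space of a face through `w` containing `Λ_n`) has `≥ n^{3-a}`
vertices within sup-distance `2n` is at most `1 - ε`.  This is a statement about ONE floor-rooted
half-space cluster `U = C_ℍ(0)` — the object of route PercLowPointHalfSpace (stmt-0911/0912/0913) and of
PercBoundarySqueeze (stmt-6983) — a.s. finite at `p_c` by Barsky–Grimmett–Newman
(`BarskyGrimmettNewman1991_Z3_holds`).  Orthodox value: `P(|U ∩ Λ_{2n}| ≥ n^{3-a})` is `π_s(n) ≍ n^{-x_s}`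
times a LARGE-DEVIATION factor (typical tall-`U` volume `n^{d_f} = n^{2.52} ≪ n^{3-a}` for `a < 0.48`),
so the hypothesis holds asymptotically with `ε → 1`, but only in the regime `n^{0.48 - a} ≫ 1` (beyond
Monte-Carlo reach: at accessible `n` a fat wall-hung piece has `≍ n^{1.09}` feet, kit j010718).
Calibration (why it is open): Markov on the volume with the TRUE exponents gives only
`54 n² · n^{d_f - x_s} / n^{3-a} = 54 n^{0.55 + a}` (`E|U ∩ Λ_{2n}| ≍ n^{d_f - x_s} = n^{1.55}`), and with
the filed items `TallClusterMassBound` (m = 11/4) + `QuantitativeBGN` (a₀ ≤ x_s) only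
`n^{2 - 1/4 - a₀ + a}`; a `k`-th moment / volume-tail input `P(t ≤ |U ∩ Λ_r|) ≤ C r^{km} t^{-k}` gives
it iff `k (3 - m) > 4` (`fatWallFeetSparse_of_volumeTail` below), orthodox-true for `k ≥ 7`; no such
bound is in the tree or in print for `d = 3`.  The hypothesis is FALSE at `p = 1` (the count is
`6(2n+1)² ≥ 6`), true below `p_c`, NOT implied by the crux (it is a rate at density `n^{-2}`, and any
crux witness has `a ≤ 2`, Disproof §5). -/
theorem boundaryQuasiGiantsNotAS_of_fatWallFeetSparse
    (hF : ∃ a ε : ℝ, 0 < a ∧ 0 < ε ∧ ∀ᶠ n : ℕ in atTop,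
      6 * (2 * (n : ℝ) + 1) ^ 2 *
          (bondPercolation (zdGraph 3) (criticalProbI 3)).real
            {ω | (n : ℝ) ^ (3 - a) ≤ (((box 3 (2 * n)).filter fun y =>
              ω ∈ openConnIn {x : Site 3 | 0 ≤ x 0} (0 : Site 3) y).card : ℝ)}
        ≤ 1 - ε) :
    ∃ a ε : ℝ, 0 < a ∧ 0 < ε ∧ ∀ᶠ n : ℕ in atTop,
      (bondPercolation (zdGraph 3) (criticalProbI 3)).real
          {ω | ∃ u ∈ innerBoundary (zdGraph 3) (box 3 n),
            (n : ℝ) ^ (3 - a) ≤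
              (((box 3 n).filter fun v => ω ∈ openConnIn ↑(box 3 n) u v).card : ℝ)}
        ≤ 1 - ε := by
  obtain ⟨a, ε, ha, hε, hev⟩ := hF
  refine ⟨a, ε, ha, hε, ?_⟩
  filter_upwards [hev] with n hn
  exact (stub_bdryQuasiGiant_le_wall (criticalProbI 3) n ((n : ℝ) ^ (3 - a))).trans hn

/-- **stub_sizeSplitting (the square-root trick: BK size-multiplicativity of the largest free-box
piece, `k = 1`; every `p`; provable now, size M).**  For real `s ≥ 1`:
`P_p(some in-box piece has ≥ 3s vertices) ≤ P_p(some in-box piece has ≥ s vertices)²`.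
Proof route (triage r1-2 App. A, re-deriving Hutchcroft arXiv:2008.11197 Thm 2.3 / Lemma 2.4 for the
finite graph `Λ_n`): a piece with `≥ 3s` vertices has a spanning open tree `T` with `|T| ≥ ⌈3s⌉ ≥ 3m-2`,
`m := ⌈s⌉`; if `m ≥ 2`, peel at a deepest vertex whose subtree has `≥ m` vertices to get two
EDGE-disjoint open subtrees with `≥ m ≥ s` vertices each (pieces `T₁` with `m ≤ |T₁| ≤ 2m-2` and
`T ∖ (T₁ ∖ root)` with `≥ m+1`), i.e. two disjoint witnesses of the increasing finitary event
"`∃` piece `≥ s`" on the edges of `Λ_n`; conclude with `bk_finitary_list` /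
`mem_disjointOccurrenceList_of_pairwise_disjoint` (in tree).  `m = 1` (i.e. `s = 1`): the right side
is `1`.  Holds at every `p` (BK is a product-measure fact). -/
theorem stub_sizeSplitting :
    ∀ (p : unitInterval) (n : ℕ) (s : ℝ), 1 ≤ s →
      (bondPercolation (zdGraph 3) p).real
          {ω | ∃ u ∈ box 3 n,
            3 * s ≤ (((box 3 n).filter fun v => ω ∈ openConnIn ↑(box 3 n) u v).card : ℝ)}
        ≤ ((bondPercolation (zdGraph 3) p).real
            {ω | ∃ u ∈ box 3 n,
              s ≤ (((box 3 n).filter fun v => ω ∈ openConnIn ↑(box 3 n) u v).card : ℝ)}) ^ 2 :=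
  Summit.CriticalPhenomena.PercolationContinuityZ3.FreeBoxPowerSavingLine.stub_sizeSplitting

/-- **stub_logBoost (tightness collapse: one bit per scale ⟹ a power saving; every `p`; real
analysis, provable now, size M).**  If the square-root trick holds at `p` and, for some `a, ε > 0`,
eventually `P_p(some in-box piece of Λ_n has ≥ n^{3-a} vertices) ≤ 1 - ε`, then for some `a' > 0`,
eventually `FA₂(p, n) ≤ C n^{-a'}` (any `a' < a` works; e.g. `a' = a/2`).
Proof route (card 1 `FirstLemma1`, triage-verified): iterate the hypothesis along `s, 3s, 9s, …`
(`3^j s ≥ 1`) to `P(QG_n(3^k s)) ≤ (1-ε)^{2^k}`; pointwise `Σ_{u ∈ Λ_n} N_n(u) ≤ |Λ_n| · max_u N_n(u)`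
and `max_u N_n(u) ≤ t + |Λ_n| · 1{QG_n(t)}`, so `Σ_{x,y} P_p(x ↔ y in Λ_n) ≤ |Λ_n| (t + |Λ_n| P(QG_n(t)))`;
take `s = n^{3-a}`, `2^k ≈ 7 log n / log(1/(1-ε))` (so `(1-ε)^{2^k} ≤ n^{-7}`, `3^k ≤ 3 (2^k)^{1.59} =
O_ε((log n)^{1.59})`), `t = 3^k s`: `FA₂ ≤ 3^k n^{3-a}/n³ + 216 n^{-4} ≤ C n^{-a/2}` eventually.
At `p = 1` the second hypothesis fails for every `a` (the box is one piece), so no conflict with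
`Negative.false_at_one`. -/
theorem stub_logBoost :
    ∀ (p : unitInterval),
      (∀ (n : ℕ) (s : ℝ), 1 ≤ s →
        (bondPercolation (zdGraph 3) p).real
            {ω | ∃ u ∈ box 3 n,
              3 * s ≤ (((box 3 n).filter fun v => ω ∈ openConnIn ↑(box 3 n) u v).card : ℝ)}
          ≤ ((bondPercolation (zdGraph 3) p).real
              {ω | ∃ u ∈ box 3 n,
                s ≤ (((box 3 n).filter fun v => ω ∈ openConnIn ↑(box 3 n) u v).card : ℝ)}) ^ 2) →
      ∀ (a ε : ℝ), 0 < a → 0 < ε →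
        (∀ᶠ n : ℕ in atTop,
          (bondPercolation (zdGraph 3) p).real
              {ω | ∃ u ∈ box 3 n,
                (n : ℝ) ^ (3 - a) ≤
                  (((box 3 n).filter fun v => ω ∈ openConnIn ↑(box 3 n) u v).card : ℝ)}
            ≤ 1 - ε) →
        ∃ a' C : ℝ, 0 < a' ∧ ∀ᶠ n : ℕ in atTop,
          (∑ x ∈ box 3 n, ∑ y ∈ box 3 n,
              (bondPercolation (zdGraph 3) p).real (openConnIn ↑(box 3 n) x y))
            / ((box 3 n).card : ℝ) ^ 2 ≤ C * (n : ℝ) ^ (-a') :=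
  Summit.CriticalPhenomena.PercolationContinuityZ3.FreeBoxPowerSavingLine.stub_logBoost

/-! ## Notation for the glue (sets and numbers only — no statement is hidden behind a name) -/

/-- `N_n(u, ω)`: number of vertices of `Λ_n` joined to `u` by an open path inside `Λ_n`
(`0` if `u ∉ Λ_n`).  The stubs spell this term out; the glue below abbreviates it. -/
def pieceSize (n : ℕ) (u : Site 3) (ω : BondConfig (Site 3)) : ℕ :=
  ((box 3 n).filter fun v => ω ∈ openConnIn ↑(box 3 n) u v).card

/-- `QG_n(s)`: some in-box piece of `Λ_n` has at least `s` vertices. -/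
def quasiGiant (n : ℕ) (s : ℝ) : Set (BondConfig (Site 3)) :=
  {ω | ∃ u ∈ box 3 n, s ≤ (pieceSize n u ω : ℝ)}

/-- `BQG_n(s)`: some in-box piece of `Λ_n` touching `∂ⁱⁿΛ_n` has at least `s` vertices. -/
def bdryQuasiGiant (n : ℕ) (s : ℝ) : Set (BondConfig (Site 3)) :=
  {ω | ∃ u ∈ innerBoundary (zdGraph 3) (box 3 n), s ≤ (pieceSize n u ω : ℝ)}

/-- `IQG_n(s)`: some in-box piece of `Λ_n` AVOIDING `∂ⁱⁿΛ_n` has at least `s` vertices. -/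
def intQuasiGiant (n : ℕ) (s : ℝ) : Set (BondConfig (Site 3)) :=
  {ω | ∃ u ∈ box 3 n, (∀ w ∈ innerBoundary (zdGraph 3) (box 3 n), ω ∉ openConnIn ↑(box 3 n) u w) ∧
    s ≤ (pieceSize n u ω : ℝ)}

/-- `E_p[|C(0)| ; C(0) ⊆ Λ_m] = Σ_{y ∈ Λ_m} P_p(0 ↔ y, C(0) ⊆ Λ_m)` (confined volume). -/
def confinedVol (p : unitInterval) (m : ℕ) : ℝ :=
  ∑ y ∈ box 3 m, (bondPercolation (zdGraph 3) p).real
    (openConn 0 y ∩ {ω | openCluster ω 0 ⊆ ↑(box 3 m)})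

/-! ## Composition (kernel-checked, no `sorry`) -/

theorem confinedVol_nonneg (p : unitInterval) (m : ℕ) : 0 ≤ confinedVol p m :=
  Finset.sum_nonneg fun _ _ => measureReal_nonneg

/-- Quasi-giant events are antitone in the threshold. -/
theorem bdryQuasiGiant_anti (n : ℕ) {s t : ℝ} (hst : s ≤ t) : bdryQuasiGiant n t ⊆ bdryQuasiGiant n s := by
  rintro ω ⟨u, hu, h⟩
  exact ⟨u, hu, hst.trans h⟩

/-- Interior quasi-giant events are antitone in the threshold. -/
theorem intQuasiGiant_anti (n : ℕ) {s t : ℝ} (hst : s ≤ t) : intQuasiGiant n t ⊆ intQuasiGiant n s := by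
  rintro ω ⟨u, hu, hw, h⟩
  exact ⟨u, hu, hw, hst.trans h⟩

/-- An interior quasi-giant is a quasi-giant. -/
theorem intQuasiGiant_subset (n : ℕ) (s : ℝ) : intQuasiGiant n s ⊆ quasiGiant n s := by
  rintro ω ⟨u, hu, _, h⟩
  exact ⟨u, hu, h⟩

/-- Pieces are classes of an equivalence relation: if `u ↔ w in Λ_n` then the piece of `w` contains
the piece of `u`. -/
theorem pieceSize_le_of_mem {n : ℕ} {u w : Site 3} {ω : BondConfig (Site 3)}
    (h : ω ∈ openConnIn (↑(box 3 n) : Set (Site 3)) u w) : pieceSize n u ω ≤ pieceSize n w ω := by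
  unfold pieceSize
  refine Finset.card_le_card fun v hv => ?_
  rw [Finset.mem_filter] at hv ⊢
  exact ⟨hv.1, GM.openConnIn_trans (FreeBoxPowerSavingNegative.openConnIn_symm_mem h) hv.2⟩

/-- **The split, pointwise (`split₀`)**: a fat piece either touches `∂ⁱⁿΛ_n` — then the piece of
the touched boundary vertex is the same piece, so `BQG` holds — or avoids it, so `IQG` holds:
`QG_n(s) ⊆ BQG_n(s) ∪ IQG_n(s)`.  (This is all the composition needs from the boundary/interior
split; the Markov/translation content of `stub_boundaryInteriorSplit` is the bridge from the
expectation form (I) to the interior stub, `intQuasiGiant_real_le_of_split` below.) -/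
theorem quasiGiant_subset_union (n : ℕ) (s : ℝ) :
    quasiGiant n s ⊆ bdryQuasiGiant n s ∪ intQuasiGiant n s := by
  rintro ω ⟨u, hu, h⟩
  by_cases hw : ∀ w ∈ innerBoundary (zdGraph 3) (box 3 n), ω ∉ openConnIn ↑(box 3 n) u w
  · exact Or.inr ⟨u, hu, hw, h⟩
  · push Not at hw
    obtain ⟨w, hw, huw⟩ := hw
    refine Or.inl ⟨w, hw, h.trans ?_⟩
    exact_mod_cast pieceSize_le_of_mem huw

/-- **Interior + boundary ⟹ all quasi-giants not a.s.** (sorry-free; hypotheses = the statements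
of the two registered stubs, definitionally): with `a := min a_B a_I`,
`P_{p_c}(QG_n(n^{3-a})) ≤ P_{p_c}(BQG_n(n^{3-a_B})) + P_{p_c}(IQG_n(n^{3-a_I})) ≤ 1 - ε/2` eventually. -/
theorem quasiGiantsNotAS_of_parts
    (hInt : ∃ a : ℝ, 0 < a ∧ Tendsto (fun n : ℕ =>
      (bondPercolation (zdGraph 3) (criticalProbI 3)).real (intQuasiGiant n ((n : ℝ) ^ (3 - a))))
        atTop (𝓝 0))
    (hBdry : ∃ a ε : ℝ, 0 < a ∧ 0 < ε ∧ ∀ᶠ n : ℕ in atTop,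
      (bondPercolation (zdGraph 3) (criticalProbI 3)).real (bdryQuasiGiant n ((n : ℝ) ^ (3 - a)))
        ≤ 1 - ε) :
    ∃ a ε : ℝ, 0 < a ∧ 0 < ε ∧ ∀ᶠ n : ℕ in atTop,
      (bondPercolation (zdGraph 3) (criticalProbI 3)).real (quasiGiant n ((n : ℝ) ^ (3 - a)))
        ≤ 1 - ε := by
  obtain ⟨aI, haI, hlim⟩ := hInt
  obtain ⟨aB, ε, haB, hε, hevB⟩ := hBdry
  set a : ℝ := min aB aI with ha_def
  have ha : 0 < a := lt_min haB haI
  have haB' : a ≤ aB := min_le_left _ _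
  have haI' : a ≤ aI := min_le_right _ _
  refine ⟨a, ε / 2, ha, by linarith, ?_⟩
  have hsmall : ∀ᶠ n : ℕ in atTop,
      (bondPercolation (zdGraph 3) (criticalProbI 3)).real (intQuasiGiant n ((n : ℝ) ^ (3 - aI)))
        ≤ ε / 2 :=
    hlim.eventually (ge_mem_nhds (by linarith))
  filter_upwards [hevB, hsmall, eventually_ge_atTop 1] with n hB hsm hn1
  have hN1 : (1 : ℝ) ≤ n := by exact_mod_cast hn1
  have hthrB : (n : ℝ) ^ (3 - aB) ≤ (n : ℝ) ^ (3 - a) :=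
    Real.rpow_le_rpow_of_exponent_le hN1 (by linarith)
  have hthrI : (n : ℝ) ^ (3 - aI) ≤ (n : ℝ) ^ (3 - a) :=
    Real.rpow_le_rpow_of_exponent_le hN1 (by linarith)
  calc (bondPercolation (zdGraph 3) (criticalProbI 3)).real (quasiGiant n ((n : ℝ) ^ (3 - a)))
      ≤ (bondPercolation (zdGraph 3) (criticalProbI 3)).real
          (bdryQuasiGiant n ((n : ℝ) ^ (3 - a)) ∪ intQuasiGiant n ((n : ℝ) ^ (3 - a))) :=
        measureReal_mono (quasiGiant_subset_union n _) (measure_ne_top _ _)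
    _ ≤ (bondPercolation (zdGraph 3) (criticalProbI 3)).real (bdryQuasiGiant n ((n : ℝ) ^ (3 - a)))
          + (bondPercolation (zdGraph 3) (criticalProbI 3)).real (intQuasiGiant n ((n : ℝ) ^ (3 - a))) :=
        measureReal_union_le _ _
    _ ≤ (bondPercolation (zdGraph 3) (criticalProbI 3)).real (bdryQuasiGiant n ((n : ℝ) ^ (3 - aB)))
          + (bondPercolation (zdGraph 3) (criticalProbI 3)).real (intQuasiGiant n ((n : ℝ) ^ (3 - aI))) := by
        gcongr ?_ + ?_
        · exact measureReal_mono (bdryQuasiGiant_anti n hthrB) (measure_ne_top _ _)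
        · exact measureReal_mono (intQuasiGiant_anti n hthrI) (measure_ne_top _ _)
    _ ≤ (1 - ε) + ε / 2 := add_le_add hB hsm
    _ = 1 - ε / 2 := by ring

/-- **Composition lemma (sorry-free; hypotheses = the registered stub statements and the two landed
stubs, definitionally).**  The conclusion is the crux UNFOLDED (`FreeBoxPowerSaving_of` restates it
by name): the two open stubs give QG-NAS at `p_c`, size splitting + log boost give an eventual power
saving, and the landed normal form `FreeBoxPowerSavingNegative.of_eventually` upgrades it to all
`n ≥ 1`. -/
theorem line_composition
    (hInt : ∃ a : ℝ, 0 < a ∧ Tendsto (fun n : ℕ =>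
      (bondPercolation (zdGraph 3) (criticalProbI 3)).real (intQuasiGiant n ((n : ℝ) ^ (3 - a))))
        atTop (𝓝 0))
    (hBdry : ∃ a ε : ℝ, 0 < a ∧ 0 < ε ∧ ∀ᶠ n : ℕ in atTop,
      (bondPercolation (zdGraph 3) (criticalProbI 3)).real (bdryQuasiGiant n ((n : ℝ) ^ (3 - a)))
        ≤ 1 - ε)
    (hSqrt : ∀ (p : unitInterval) (n : ℕ) (s : ℝ), 1 ≤ s →
      (bondPercolation (zdGraph 3) p).real (quasiGiant n (3 * s))
        ≤ ((bondPercolation (zdGraph 3) p).real (quasiGiant n s)) ^ 2)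
    (hBoost : ∀ p : unitInterval,
      (∀ (n : ℕ) (s : ℝ), 1 ≤ s →
        (bondPercolation (zdGraph 3) p).real (quasiGiant n (3 * s))
          ≤ ((bondPercolation (zdGraph 3) p).real (quasiGiant n s)) ^ 2) →
      ∀ (a ε : ℝ), 0 < a → 0 < ε →
        (∀ᶠ n : ℕ in atTop,
          (bondPercolation (zdGraph 3) p).real (quasiGiant n ((n : ℝ) ^ (3 - a))) ≤ 1 - ε) →
        ∃ a' C : ℝ, 0 < a' ∧ ∀ᶠ n : ℕ in atTop, fa2 p n ≤ C * (n : ℝ) ^ (-a')) :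
    ∃ a C : ℝ, 0 < a ∧ ∀ n : ℕ, 1 ≤ n →
      (∑ x ∈ box 3 n, ∑ y ∈ box 3 n,
          (bondPercolation (zdGraph 3) (criticalProbI 3)).real (openConnIn ↑(box 3 n) x y))
        / ((box 3 n).card : ℝ) ^ 2 ≤ C * (n : ℝ) ^ (-a) := by
  obtain ⟨a, ε, ha, hε, hQG⟩ := quasiGiantsNotAS_of_parts hInt hBdry
  obtain ⟨a', C, ha', hev⟩ := hBoost (criticalProbI 3) (hSqrt (criticalProbI 3)) a ε ha hε hQG
  obtain ⟨C', hC'⟩ := of_eventually ha' hev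
  exact ⟨a', C', ha', fun n hn => hC' n hn⟩

/-- **The line concludes the crux BY NAME** from the two registered stubs (plus the two landed
ones); no `sorry` of its own. -/
theorem FreeBoxPowerSaving_of :
    Summit.CriticalPhenomena.PercolationContinuityZ3.Theses.PercNonProliferation.FreeBoxPowerSaving :=
  line_composition stub_confinedQuasiGiantsVanish stub_boundaryQuasiGiantsNotAS stub_sizeSplitting
    stub_logBoost

/-! ## Converses: the transfer is lossless (kernel-checked) -/

/-- **Crux ⟹ (I₁)**: interior quasi-giants are quasi-giants, which vanish under the crux
(landed `FreeBoxPowerSavingNegative.quasiGiant_tendsto_zero_of_freeBoxPowerSaving`, p81641). -/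
theorem confinedQuasiGiantsVanish_of_crux
    (h : Summit.CriticalPhenomena.PercolationContinuityZ3.Theses.PercNonProliferation.FreeBoxPowerSaving) :
    ∃ a : ℝ, 0 < a ∧ Tendsto (fun n : ℕ =>
      (bondPercolation (zdGraph 3) (criticalProbI 3)).real (intQuasiGiant n ((n : ℝ) ^ (3 - a))))
        atTop (𝓝 0) := by
  obtain ⟨a, ha, hlim⟩ := FreeBoxPowerSavingNegative.quasiGiant_tendsto_zero_of_freeBoxPowerSaving h
  refine ⟨a, ha, tendsto_of_tendsto_of_tendsto_of_le_of_le' tendsto_const_nhds hlim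
    (Eventually.of_forall fun n => measureReal_nonneg) (Eventually.of_forall fun n => ?_)⟩
  exact measureReal_mono (intQuasiGiant_subset n _) (measure_ne_top _ _)

/-- **The transfer is lossless: crux ⟺ (I₁) ∧ (B)** — `⟸` is the line (`line_composition` with the
two landed stubs), `⟹` is `confinedQuasiGiantsVanish_of_crux` and the landed
`FreeBoxPowerSavingNegative.boundaryQuasiGiantsNotAS_of_freeBoxPowerSaving` (p81641).  So neither open
stub is stronger than the crux, and together they are exactly the crux. -/
theorem crux_iff_parts :
    Summit.CriticalPhenomena.PercolationContinuityZ3.Theses.PercNonProliferation.FreeBoxPowerSaving ↔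
      ((∃ a : ℝ, 0 < a ∧ Tendsto (fun n : ℕ =>
          (bondPercolation (zdGraph 3) (criticalProbI 3)).real (intQuasiGiant n ((n : ℝ) ^ (3 - a))))
            atTop (𝓝 0)) ∧
        (∃ a ε : ℝ, 0 < a ∧ 0 < ε ∧ ∀ᶠ n : ℕ in atTop,
          (bondPercolation (zdGraph 3) (criticalProbI 3)).real (bdryQuasiGiant n ((n : ℝ) ^ (3 - a)))
            ≤ 1 - ε)) :=
  ⟨fun h => ⟨confinedQuasiGiantsVanish_of_crux h,
      FreeBoxPowerSavingNegative.boundaryQuasiGiantsNotAS_of_freeBoxPowerSaving h⟩,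
    fun h => line_composition h.1 h.2 stub_sizeSplitting stub_logBoost⟩

/-! ## Other sufficient entries (kernel-checked) -/

/-- **Polynomially-rare shattering at `p_c` proves the crux** (landed: the boost
`FreeBoxPowerSavingLine.Boost.freeBoxPowerSaving_of_polyRareShattering`, p96610, condition
`b log 3 < a log 2`; the SHARP form via multiple size splitting,
`FreeBoxPowerSavingLine.MultiSplit.freeBoxPowerSaving_of_polyRareShattering_sharp`, p97460, any `b < a`):
if for some `0 < b < a` eventually `P_{p_c}(no piece of Λ_n has ≥ n^{3-a} vertices) ≥ n^{-b}`, the crux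
holds.  Modulo landed theorems the crux, QG-NAS, (I₁) ∧ (B) and polynomially-rare shattering are all
EQUIVALENT (the converse `crux ⟹ P_{p_c}(shatter) → 1` is `quasiGiant_tendsto_zero_of_freeBoxPowerSaving`). -/
theorem FreeBoxPowerSaving_of_polyRareShattering {a b : ℝ} (hb : 0 < b) (hab : b < a)
    (h : ∀ᶠ n : ℕ in atTop, (n : ℝ) ^ (-b) ≤
      1 - (bondPercolation (zdGraph 3) (criticalProbI 3)).real (quasiGiant n ((n : ℝ) ^ (3 - a)))) :
    Summit.CriticalPhenomena.PercolationContinuityZ3.Theses.PercNonProliferation.FreeBoxPowerSaving :=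
  FreeBoxPowerSavingLine.MultiSplit.freeBoxPowerSaving_of_polyRareShattering_sharp hb hab h

/-- **Crux ⟺ polynomially-rare shattering at `p_c`** (kernel-checked normal form of the residual of
both lines of this crux): `FreeBoxPowerSaving` holds iff for some `0 < b < a`, eventually in `n`, with
probability at least `n^{-b}` NO in-box piece of the critical free box `Λ_n` has `≥ n^{3-a}` vertices.
(`⟸`: the sharp boost, p97460; `⟹`: under the crux that probability tends to `1`, p81641.) -/
theorem crux_iff_polyRareShattering :
    Summit.CriticalPhenomena.PercolationContinuityZ3.Theses.PercNonProliferation.FreeBoxPowerSaving ↔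
      ∃ a b : ℝ, 0 < b ∧ b < a ∧ ∀ᶠ n : ℕ in atTop, (n : ℝ) ^ (-b) ≤
        1 - (bondPercolation (zdGraph 3) (criticalProbI 3)).real (quasiGiant n ((n : ℝ) ^ (3 - a))) := by
  refine ⟨fun h => ?_, fun ⟨a, b, hb, hab, h⟩ => FreeBoxPowerSaving_of_polyRareShattering hb hab h⟩
  obtain ⟨a₀, ha₀, hlim⟩ := FreeBoxPowerSavingNegative.quasiGiant_tendsto_zero_of_freeBoxPowerSaving h
  refine ⟨a₀, a₀ / 2, by linarith, by linarith, ?_⟩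
  have hq : ∀ᶠ n : ℕ in atTop, (bondPercolation (zdGraph 3) (criticalProbI 3)).real
      (quasiGiant n ((n : ℝ) ^ (3 - a₀))) ≤ 1 / 2 :=
    hlim.eventually (ge_mem_nhds (by norm_num))
  have hpow : ∀ᶠ n : ℕ in atTop, (n : ℝ) ^ (-(a₀ / 2)) ≤ 1 / 2 := by
    have h := (tendsto_rpow_neg_atTop (by linarith : 0 < a₀ / 2)).comp tendsto_natCast_atTop_atTop
    exact h.eventually (ge_mem_nhds (by norm_num))
  filter_upwards [hq, hpow] with n hqn hpn
  linarith

/-- Real arithmetic of the volume-tail exchange rate: if `0 ≤ P ≤ C (2n)^{km} / (n^{3-a})^k` with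
`a = (3-m)/2` and `n ≥ 1`, then `6 (2n+1)² P ≤ 54 C⁺ 2^{km} · n^{-(k(3-m)/2 - 2)}`. -/
theorem feet_arith {k : ℕ} {m C P n : ℝ} (hn : 1 ≤ n) (hP0 : 0 ≤ P)
    (hP : P ≤ C * (2 * n) ^ ((k : ℝ) * m) / (n ^ (3 - (3 - m) / 2)) ^ k) :
    6 * (2 * n + 1) ^ 2 * P ≤
      54 * max C 0 * (2 : ℝ) ^ ((k : ℝ) * m) * n ^ (-((k : ℝ) * (3 - m) / 2 - 2)) := by
  have hn0 : 0 < n := by linarith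
  set A : ℝ := (2 * n) ^ ((k : ℝ) * m) with hA
  set D : ℝ := (n ^ (3 - (3 - m) / 2)) ^ k with hD
  have hA0 : 0 ≤ A := Real.rpow_nonneg (by linarith) _
  have hD0 : 0 < D := pow_pos (Real.rpow_pos_of_pos hn0 _) k
  have hAD : 0 ≤ A / D := div_nonneg hA0 hD0.le
  have hP' : P ≤ max C 0 * (A / D) := by
    calc P ≤ C * A / D := hP
      _ = C * (A / D) := by ring
      _ ≤ max C 0 * (A / D) := mul_le_mul_of_nonneg_right (le_max_left _ _) hAD
  have hsq : (2 * n + 1) ^ 2 ≤ 9 * n ^ (2 : ℝ) := by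
    rw [Real.rpow_two]
    nlinarith
  have hA' : A = (2 : ℝ) ^ ((k : ℝ) * m) * n ^ ((k : ℝ) * m) := by
    rw [hA, Real.mul_rpow (by norm_num) hn0.le]
  have hD' : D = n ^ ((3 - (3 - m) / 2) * k) := by
    rw [hD, ← Real.rpow_natCast, ← Real.rpow_mul hn0.le]
  have hexp : n ^ (2 : ℝ) * n ^ ((k : ℝ) * m) / n ^ ((3 - (3 - m) / 2) * k) =
      n ^ (-((k : ℝ) * (3 - m) / 2 - 2)) := by
    rw [← Real.rpow_add hn0, ← Real.rpow_sub hn0]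
    congr 1
    ring
  calc 6 * (2 * n + 1) ^ 2 * P ≤ 6 * (9 * n ^ (2 : ℝ)) * (max C 0 * (A / D)) := by
        gcongr
    _ = 54 * max C 0 * (2 : ℝ) ^ ((k : ℝ) * m) *
          (n ^ (2 : ℝ) * n ^ ((k : ℝ) * m) / n ^ ((3 - (3 - m) / 2) * k)) := by
        rw [hA', hD']; ring
    _ = 54 * max C 0 * (2 : ℝ) ^ ((k : ℝ) * m) * n ^ (-((k : ℝ) * (3 - m) / 2 - 2)) := by
        rw [hexp]

/-- **Exchange rate for route W (kernel-checked): a polynomial volume tail for the floor-rooted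
half-space cluster gives the hypothesis `FatWallFeetSparse` of
`boundaryQuasiGiantsNotAS_of_fatWallFeetSparse`.**  If for some `k : ℕ`, `m`, `C` with `k (3 - m) > 4`,
for all `r ≥ 1` and `t > 0`,
`P_{p_c}(t ≤ #{y ∈ Λ_r : 0 ↔ y inside ℍ}) ≤ C r^{km} / t^k`
(the Markov form of a `k`-th moment bound `E_{p_c}[#{y ∈ Λ_r : 0 ↔_ℍ y}^k] ≤ C r^{km}`), then the
expected number of fat wall feet satisfies `6(2n+1)² P_{p_c}(n^{3-a} ≤ #{y ∈ Λ_{2n} : 0 ↔_ℍ y}) ≤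
54 C⁺ 2^{km} n^{2 - k(3-m)/2} → 0` with `a = (3-m)/2`, so `FatWallFeetSparse(a, 1/2)` holds.
`k = 1` never qualifies (`3 - m > 4` is impossible for a volume exponent `m ≥ 0`: the first-moment /
Markov route to (B) is dead at every wall-mass exponent); orthodox values `E|U ∩ Λ_r|^k ≍
r^{k d_f - x_s}`, `d_f = 2.523`, `x_s = 0.975` make the hypothesis true iff `k m ≥ k d_f - x_s`, compatible
with `k(3-m) > 4` exactly for `k ≥ 7`. -/
theorem fatWallFeetSparse_of_volumeTail {k : ℕ} {m C : ℝ} (hkm : 4 < (k : ℝ) * (3 - m))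
    (hTail : ∀ r : ℕ, 1 ≤ r → ∀ t : ℝ, 0 < t →
      (bondPercolation (zdGraph 3) (criticalProbI 3)).real
          {ω | t ≤ (((box 3 r).filter fun y =>
            ω ∈ openConnIn {x : Site 3 | 0 ≤ x 0} (0 : Site 3) y).card : ℝ)}
        ≤ C * (r : ℝ) ^ ((k : ℝ) * m) / t ^ k) :
    ∃ a ε : ℝ, 0 < a ∧ 0 < ε ∧ ∀ᶠ n : ℕ in atTop,
      6 * (2 * (n : ℝ) + 1) ^ 2 *
          (bondPercolation (zdGraph 3) (criticalProbI 3)).real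
            {ω | (n : ℝ) ^ (3 - a) ≤ (((box 3 (2 * n)).filter fun y =>
              ω ∈ openConnIn {x : Site 3 | 0 ≤ x 0} (0 : Site 3) y).card : ℝ)}
        ≤ 1 - ε := by
  have h3m : 0 < 3 - m := by
    by_contra h
    push Not at h
    have : (k : ℝ) * (3 - m) ≤ 0 := mul_nonpos_of_nonneg_of_nonpos (Nat.cast_nonneg k) h
    linarith
  refine ⟨(3 - m) / 2, 1 / 2, by positivity, by norm_num, ?_⟩
  set e : ℝ := (k : ℝ) * (3 - m) / 2 - 2 with he_def
  have he : 0 < e := by rw [he_def]; linarith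
  set K : ℝ := 54 * max C 0 * (2 : ℝ) ^ ((k : ℝ) * m) with hK_def
  have hlim : Tendsto (fun n : ℕ => K * (n : ℝ) ^ (-e)) atTop (𝓝 0) := by
    have h := ((tendsto_rpow_neg_atTop he).comp tendsto_natCast_atTop_atTop).const_mul K
    simpa using h
  have hev : ∀ᶠ n : ℕ in atTop, K * (n : ℝ) ^ (-e) ≤ 1 / 2 :=
    hlim.eventually (ge_mem_nhds (by norm_num))
  filter_upwards [hev, eventually_ge_atTop 1] with n hn hn1
  have hN1 : (1 : ℝ) ≤ n := by exact_mod_cast hn1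
  have hN0 : (0 : ℝ) < n := by linarith
  have ht : 0 < (n : ℝ) ^ (3 - (3 - m) / 2) := Real.rpow_pos_of_pos hN0 _
  have hP := hTail (2 * n) (by omega) _ ht
  have hcast : ((2 * n : ℕ) : ℝ) = 2 * (n : ℝ) := by push_cast; ring
  rw [hcast] at hP
  calc 6 * (2 * (n : ℝ) + 1) ^ 2 *
        (bondPercolation (zdGraph 3) (criticalProbI 3)).real
          {ω | (n : ℝ) ^ (3 - (3 - m) / 2) ≤ (((box 3 (2 * n)).filter fun y =>
            ω ∈ openConnIn {x : Site 3 | 0 ≤ x 0} (0 : Site 3) y).card : ℝ)}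
      ≤ K * (n : ℝ) ^ (-e) := feet_arith hN1 measureReal_nonneg hP
    _ ≤ 1 / 2 := hn
    _ = 1 - 1 / 2 := by norm_num

/-- `|Λ_n| ≤ 27 n³` for `n ≥ 1`. -/
theorem card_box_le {n : ℕ} (hn : 1 ≤ n) : ((box 3 n).card : ℝ) ≤ 27 * (n : ℝ) ^ 3 := by
  have hn' : (1 : ℝ) ≤ n := by exact_mod_cast hn
  rw [card_box_real]
  have h3 : 2 * (n : ℝ) + 1 ≤ 3 * n := by linarith
  calc (2 * (n : ℝ) + 1) ^ 3 ≤ (3 * n) ^ 3 := by gcongr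
    _ = 27 * (n : ℝ) ^ 3 := by ring

/-- The interior error term of the expectation route: `|Λ_n| · CV(2n) / (n^{3-a})² ≤ 27 C⁺ n^{-a_I/2}`
when `CV(2n) ≤ C_I n^{3-a_I}` and `a ≤ a_I / 4`. -/
theorem interior_term_le {n : ℕ} (hn : 1 ≤ n) {a aI CI V : ℝ} (hV0 : 0 ≤ V)
    (hV : V ≤ CI * (n : ℝ) ^ (3 - aI)) (ha : a ≤ aI / 4) :
    ((box 3 n).card : ℝ) * V / ((n : ℝ) ^ (3 - a)) ^ 2 ≤ 27 * max CI 0 * (n : ℝ) ^ (-(aI / 2)) := by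
  have hN1 : (1 : ℝ) ≤ n := by exact_mod_cast hn
  have hN0 : (0 : ℝ) < n := by linarith
  have hM : 0 ≤ max CI 0 := le_max_right _ _
  have hV' : V ≤ max CI 0 * (n : ℝ) ^ (3 - aI) :=
    hV.trans (mul_le_mul_of_nonneg_right (le_max_left _ _) (Real.rpow_nonneg hN0.le _))
  have hpow3 : (n : ℝ) ^ (3 : ℕ) = (n : ℝ) ^ (3 : ℝ) := by
    rw [show (3 : ℝ) = ((3 : ℕ) : ℝ) by norm_num, Real.rpow_natCast]
  have hsq : ((n : ℝ) ^ (3 - a)) ^ 2 = (n : ℝ) ^ ((3 - a) + (3 - a)) := by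
    rw [sq, ← Real.rpow_add hN0]
  have hden : 0 < (n : ℝ) ^ ((3 - a) + (3 - a)) := Real.rpow_pos_of_pos hN0 _
  rw [hsq, div_le_iff₀ hden]
  calc ((box 3 n).card : ℝ) * V ≤ (27 * (n : ℝ) ^ 3) * (max CI 0 * (n : ℝ) ^ (3 - aI)) :=
        mul_le_mul (card_box_le hn) hV' hV0 (by positivity)
    _ = 27 * max CI 0 * ((n : ℝ) ^ (3 : ℝ) * (n : ℝ) ^ (3 - aI)) := by rw [← hpow3]; ring
    _ = 27 * max CI 0 * (n : ℝ) ^ (3 + (3 - aI)) := by rw [← Real.rpow_add hN0]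
    _ ≤ 27 * max CI 0 * (n : ℝ) ^ (-(aI / 2) + ((3 - a) + (3 - a))) := by
        apply mul_le_mul_of_nonneg_left _ (by positivity)
        exact Real.rpow_le_rpow_of_exponent_le hN1 (by linarith)
    _ = 27 * max CI 0 * (n : ℝ) ^ (-(aI / 2)) * (n : ℝ) ^ ((3 - a) + (3 - a)) := by
        rw [Real.rpow_add hN0]; ring

/-- **The expectation route (the planner's original stubs) still closes the line**: the interior
stub (I₁) follows from any bound `P(IQG_n(s)) ≤ |Λ_n| · CV(2n) / s²` (the first-Markov + translation
half of `stub_boundaryInteriorSplit`) together with the expectation form (I)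
`CV(2n) ≤ C n^{3-a_I}` — with `a := a_I / 4`, `P(IQG_n(n^{3-a})) ≤ 27 C⁺ n^{-a_I/2} → 0`. -/
theorem confinedQuasiGiantsVanish_of_expectation
    (hMarkov : ∀ (n : ℕ) (s : ℝ), 0 < s →
      (bondPercolation (zdGraph 3) (criticalProbI 3)).real (intQuasiGiant n s)
        ≤ ((box 3 n).card : ℝ) * confinedVol (criticalProbI 3) (2 * n) / s ^ 2)
    (hFat : ∃ a C : ℝ, 0 < a ∧ ∀ n : ℕ, 1 ≤ n →
      confinedVol (criticalProbI 3) (2 * n) ≤ C * (n : ℝ) ^ (3 - a)) :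
    ∃ a : ℝ, 0 < a ∧ Tendsto (fun n : ℕ =>
      (bondPercolation (zdGraph 3) (criticalProbI 3)).real (intQuasiGiant n ((n : ℝ) ^ (3 - a))))
        atTop (𝓝 0) := by
  obtain ⟨aI, CI, haI, hCV⟩ := hFat
  refine ⟨aI / 4, by linarith, ?_⟩
  have hlim : Tendsto (fun n : ℕ => 27 * max CI 0 * (n : ℝ) ^ (-(aI / 2))) atTop (𝓝 0) := by
    have h := ((tendsto_rpow_neg_atTop (by linarith : 0 < aI / 2)).comp
      tendsto_natCast_atTop_atTop).const_mul (27 * max CI 0)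
    simpa using h
  refine tendsto_of_tendsto_of_tendsto_of_le_of_le' tendsto_const_nhds hlim
    (Eventually.of_forall fun n => measureReal_nonneg) ?_
  filter_upwards [eventually_ge_atTop 1] with n hn1
  have hN0 : (0 : ℝ) < n := by exact_mod_cast hn1
  have hs : 0 < (n : ℝ) ^ (3 - aI / 4) := Real.rpow_pos_of_pos hN0 _
  exact (hMarkov n _ hs).trans (interior_term_le hn1 (confinedVol_nonneg _ _) (hCV n hn1) le_rfl)

/-- **First moment + translation for interior quasi-giants** (the interior half of the landed
`stub_boundaryInteriorSplit`, re-run for the event `IQG` with its helpers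
`BoundaryInteriorSplit.mul_measureReal_le_sum / centred_piece / sum_indicator_eq_card`): for `s > 0`,
`P_p(IQG_n(s)) ≤ |Λ_n| · CV_p(2n) / s²`. -/
theorem intQuasiGiant_real_le (p : unitInterval) (n : ℕ) {s : ℝ} (hs : 0 < s) :
    (bondPercolation (zdGraph 3) p).real (intQuasiGiant n s)
      ≤ ((box 3 n).card : ℝ) * confinedVol p (2 * n) / s ^ 2 := by
  have hTm : ∀ y : Site 3, MeasurableSet (openConn (0 : Site 3) y ∩
      {ω : BondConfig (Site 3) | openCluster ω 0 ⊆ ↑(box 3 (2 * n))}) := fun y =>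
    (measurableSet_openConn_holds 0 y).inter
      (FreeBoxPowerSavingLine.BoundaryInteriorSplit.measurableSet_cluster_subset 0 _)
  set A0 : Set (BondConfig (Site 3)) := {ω | s ≤ ∑ y ∈ box 3 (2 * n), (openConn (0 : Site 3) y ∩
      {ω' : BondConfig (Site 3) | openCluster ω' 0 ⊆ ↑(box 3 (2 * n))}).indicator
        (1 : BondConfig (Site 3) → ℝ) ω} with hA0
  have hA0m : MeasurableSet A0 :=
    measurableSet_le measurable_const
      (Finset.measurable_sum _ fun y _ => measurable_one.indicator (hTm y))
  -- pointwise: on `IQG ∩ {ω ⊆ E}` at least `s` recentred events occur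
  have hptw : ∀ ω : BondConfig (Site 3), ω ⊆ (zdGraph 3).edgeSet → ω ∈ intQuasiGiant n s →
      s ≤ ∑ v ∈ box 3 n, (BondConfig.relabel (sym2Equiv (Site.shift (-v))) ⁻¹' A0).indicator
        (1 : BondConfig (Site 3) → ℝ) ω := by
    intro ω hω ⟨u, hu, hw, hsu⟩
    set P := (box 3 n).filter fun v => ω ∈ openConnIn (↑(box 3 n) : Set (Site 3)) u v with hP
    have hint : ∀ w ∈ P, w ∉ innerBoundary (zdGraph 3) (box 3 n) := by
      intro w hwP hwB
      exact hw w hwB (Finset.mem_filter.1 hwP).2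
    have hmem : ∀ v ∈ P, ω ∈ BondConfig.relabel (sym2Equiv (Site.shift (-v))) ⁻¹' A0 := by
      intro v hv
      obtain ⟨hcard, hC⟩ :=
        FreeBoxPowerSavingLine.BoundaryInteriorSplit.centred_piece n hω hu hint hv
      show s ≤ ∑ y ∈ box 3 (2 * n), (openConn (0 : Site 3) y ∩
        {ω'' : BondConfig (Site 3) | openCluster ω'' 0 ⊆ ↑(box 3 (2 * n))}).indicator
          (1 : BondConfig (Site 3) → ℝ) (BondConfig.relabel (sym2Equiv (Site.shift (-v))) ω)
      rw [FreeBoxPowerSavingLine.BoundaryInteriorSplit.sum_indicator_eq_card _ _ _ hC]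
      have hsu' : s ≤ (P.card : ℝ) := hsu
      exact hsu'.trans (by exact_mod_cast hcard)
    calc s ≤ (P.card : ℝ) := hsu
      _ = ∑ v ∈ P, (BondConfig.relabel (sym2Equiv (Site.shift (-v))) ⁻¹' A0).indicator
            (1 : BondConfig (Site 3) → ℝ) ω := by
          rw [Finset.sum_congr rfl fun v hv =>
            Set.indicator_of_mem (hmem v hv) (1 : BondConfig (Site 3) → ℝ)]
          simp
      _ ≤ ∑ v ∈ box 3 n, (BondConfig.relabel (sym2Equiv (Site.shift (-v))) ⁻¹' A0).indicator
            (1 : BondConfig (Site 3) → ℝ) ω :=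
          Finset.sum_le_sum_of_subset_of_nonneg (Finset.filter_subset _ _) fun _ _ _ =>
            Set.indicator_nonneg (fun _ _ => zero_le_one) _
  have h2 := FreeBoxPowerSavingLine.BoundaryInteriorSplit.mul_measureReal_le_sum
    (bondPercolation (zdGraph 3) p) (box 3 n)
    (fun v => BondConfig.relabel (sym2Equiv (Site.shift (-v))) ⁻¹' A0)
    (fun v _ => hA0m.preimage (BondConfig.relabel _).measurable)
    (intQuasiGiant n s) hs.le (by
      filter_upwards [ae_subset_edgeSet (zdGraph 3) p] with ω hω hI
      exact hptw ω hω hI)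
  have h3 : ∑ v ∈ box 3 n, (bondPercolation (zdGraph 3) p).real
      (BondConfig.relabel (sym2Equiv (Site.shift (-v))) ⁻¹' A0) =
      ((box 3 n).card : ℝ) * (bondPercolation (zdGraph 3) p).real A0 := by
    rw [Finset.sum_congr rfl fun v _ => bondPercolation_real_preimage_shift (-v) p A0,
      Finset.sum_const, nsmul_eq_mul]
  have h4 := FreeBoxPowerSavingLine.BoundaryInteriorSplit.mul_measureReal_le_sum
    (bondPercolation (zdGraph 3) p) (box 3 (2 * n))
    (fun y => openConn (0 : Site 3) y ∩
      {ω : BondConfig (Site 3) | openCluster ω 0 ⊆ ↑(box 3 (2 * n))})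
    (fun y _ => hTm y) A0 hs.le (ae_of_all _ fun ω hω => hω)
  -- bookkeeping: `s μ(IQG) ≤ N μ(A₀)`, `s μ(A₀) ≤ CV` ⟹ `μ(IQG) ≤ N CV / s²`
  have hkey : s * (bondPercolation (zdGraph 3) p).real (intQuasiGiant n s) ≤
      ((box 3 n).card : ℝ) * (bondPercolation (zdGraph 3) p).real A0 := h2.trans_eq h3
  have hCV : s * (bondPercolation (zdGraph 3) p).real A0 ≤ confinedVol p (2 * n) := h4
  rw [le_div_iff₀ (pow_pos hs 2)]
  calc (bondPercolation (zdGraph 3) p).real (intQuasiGiant n s) * s ^ 2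
      = (s * (bondPercolation (zdGraph 3) p).real (intQuasiGiant n s)) * s := by ring
    _ ≤ (((box 3 n).card : ℝ) * (bondPercolation (zdGraph 3) p).real A0) * s :=
        mul_le_mul_of_nonneg_right hkey hs.le
    _ = ((box 3 n).card : ℝ) * (s * (bondPercolation (zdGraph 3) p).real A0) := by ring
    _ ≤ ((box 3 n).card : ℝ) * confinedVol p (2 * n) :=
        mul_le_mul_of_nonneg_left hCV (Nat.cast_nonneg _)

/-- **(I) ⟹ (I₁): the planner's expectation stub implies the registered interior stub** — so
`stub_fatFiniteClusters` (kept below as a SUFFICIENT statement, no longer registered) together with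
`stub_boundaryQuasiGiantsNotAS` still closes the line (`FreeBoxPowerSaving_of_fatFiniteClusters`). -/
theorem confinedQuasiGiantsVanish_of_fatFiniteClusters
    (hFat : ∃ a C : ℝ, 0 < a ∧ ∀ n : ℕ, 1 ≤ n →
      confinedVol (criticalProbI 3) (2 * n) ≤ C * (n : ℝ) ^ (3 - a)) :
    ∃ a : ℝ, 0 < a ∧ Tendsto (fun n : ℕ =>
      (bondPercolation (zdGraph 3) (criticalProbI 3)).real (intQuasiGiant n ((n : ℝ) ^ (3 - a))))
        atTop (𝓝 0) :=
  confinedQuasiGiantsVanish_of_expectation (fun n _ hs => intQuasiGiant_real_le _ n hs) hFat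

/-- **The planner's original pair (I) ∧ (B) closes the line** (kernel-checked): the expectation form
(I) `E_{p_c}[|C(0)|; C(0) ⊆ Λ_{2n}] ≤ C n^{3-a}` (= the archived `stub_fatFiniteClusters`, VERBATIM up
to the abbreviation `confinedVol`) and the registered boundary stub give the crux. -/
theorem FreeBoxPowerSaving_of_fatFiniteClusters
    (hFat : ∃ a C : ℝ, 0 < a ∧ ∀ n : ℕ, 1 ≤ n →
      confinedVol (criticalProbI 3) (2 * n) ≤ C * (n : ℝ) ^ (3 - a))
    (hBdry : ∃ a ε : ℝ, 0 < a ∧ 0 < ε ∧ ∀ᶠ n : ℕ in atTop,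
      (bondPercolation (zdGraph 3) (criticalProbI 3)).real (bdryQuasiGiant n ((n : ℝ) ^ (3 - a)))
        ≤ 1 - ε) :
    Summit.CriticalPhenomena.PercolationContinuityZ3.Theses.PercNonProliferation.FreeBoxPowerSaving :=
  line_composition (confinedQuasiGiantsVanish_of_fatFiniteClusters hFat) hBdry stub_sizeSplitting
    stub_logBoost

/-- **Exchange rate for the interior residual (kernel-checked): ANY power-law upper tail for the
volume of the FINITE critical cluster gives (I₁).**  If for some `c₀ > 0` and `C`,
`P_{p_c}(|C(0)| < ∞ ∧ s ≤ |C(0)|) ≤ C s^{-c₀}` for all real `s ≥ 1` ("`1/δ > 0` for finite clusters" — a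
jump-free statement: in a `θ(p_c) > 0` world it constrains only the finite clusters; it is NOT implied by
the crux and does not imply it), then `stub_confinedQuasiGiantsVanish` holds with `a = min(c₀,1)/2`:
the centred event of the landed first-moment reduction
(`FreeBoxPowerSavingLine.confinedQuasiGiantsVanish_of_centredRate`, p99710) is contained in
`{|C(0)| < ∞ ∧ n^{3-a} ≤ |C(0)|}`, so `n^a · P(centred) ≤ C⁺ n^{a - (3-a)c₀} → 0`.  No such tail bound is
known for `ℤ³` (Hutchcroft 2020, arXiv:1901.10363, Thm 1.1 is conditional on exactly this hypothesis;
the tree and the located literature have only the Aizenman–Barsky LOWER bound `≥ c s^{-1/2}`). -/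
theorem confinedQuasiGiantsVanish_of_finiteClusterTail
    (hTail : ∃ c₀ C : ℝ, 0 < c₀ ∧ ∀ s : ℝ, 1 ≤ s →
      (bondPercolation (zdGraph 3) (criticalProbI 3)).real
        {ω | (openCluster ω (0 : Site 3)).Finite ∧ s ≤ ((openCluster ω (0 : Site 3)).ncard : ℝ)}
        ≤ C * s ^ (-c₀)) :
    ∃ a : ℝ, 0 < a ∧ Tendsto (fun n : ℕ =>
      (bondPercolation (zdGraph 3) (criticalProbI 3)).real
          {ω | ∃ u ∈ box 3 n,
            (∀ w ∈ innerBoundary (zdGraph 3) (box 3 n), ω ∉ openConnIn ↑(box 3 n) u w) ∧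
            (n : ℝ) ^ (3 - a) ≤
              (((box 3 n).filter fun v => ω ∈ openConnIn ↑(box 3 n) u v).card : ℝ)}) atTop (𝓝 0) := by
  obtain ⟨c₀, C, hc₀, hT⟩ := hTail
  set a : ℝ := min c₀ 1 / 2 with ha_def
  have hmin : 0 < min c₀ 1 := lt_min hc₀ one_pos
  have ha : 0 < a := by rw [ha_def]; linarith
  have ha1 : a ≤ 1 / 2 := by
    rw [ha_def]; linarith [min_le_right c₀ 1]
  have hac : a ≤ c₀ / 2 := by
    rw [ha_def]; linarith [min_le_left c₀ 1]
  apply FreeBoxPowerSavingLine.confinedQuasiGiantsVanish_of_centredRate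
  refine ⟨a, ha, ?_⟩
  set μ := bondPercolation (zdGraph 3) (criticalProbI 3) with hμ
  set e : ℝ := (3 - a) * c₀ - a with he_def
  have he : 0 < e := by rw [he_def]; nlinarith
  have hlim : Tendsto (fun n : ℕ => max C 0 * (n : ℝ) ^ (-e)) atTop (𝓝 0) := by
    have h := ((tendsto_rpow_neg_atTop he).comp tendsto_natCast_atTop_atTop).const_mul (max C 0)
    simpa using h
  refine tendsto_of_tendsto_of_tendsto_of_le_of_le' tendsto_const_nhds hlim
    (Eventually.of_forall fun n => by positivity) ?_
  filter_upwards [eventually_ge_atTop 1] with n hn1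
  have hN1 : (1 : ℝ) ≤ n := by exact_mod_cast hn1
  have hN0 : (0 : ℝ) < n := by linarith
  -- the centred event lies inside the finite-cluster tail event at `s = n^{3-a}`
  have hsub : {ω : BondConfig (Site 3) | (n : ℝ) ^ (3 - a) ≤
        (((box 3 (2 * n)).filter fun y => ω ∈ openConn 0 y).card : ℝ) ∧
        openCluster ω 0 ⊆ ↑(box 3 (2 * n))} ⊆
      {ω | (openCluster ω (0 : Site 3)).Finite ∧
        (n : ℝ) ^ (3 - a) ≤ ((openCluster ω (0 : Site 3)).ncard : ℝ)} := by
    rintro ω ⟨hcard, hconf⟩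
    have hfin : (openCluster ω (0 : Site 3)).Finite := (Finset.finite_toSet _).subset hconf
    refine ⟨hfin, hcard.trans ?_⟩
    have hF : (↑((box 3 (2 * n)).filter fun y => ω ∈ openConn 0 y) : Set (Site 3)) ⊆
        openCluster ω 0 := by
      intro y hy
      rw [Finset.coe_filter] at hy
      exact hy.2
    exact_mod_cast (Set.ncard_coe_finset _).symm.le.trans (Set.ncard_le_ncard hF hfin)
  have hs1 : (1 : ℝ) ≤ (n : ℝ) ^ (3 - a) := Real.one_le_rpow hN1 (by linarith)
  have hP := (measureReal_mono hsub (measure_ne_top μ _)).trans (hT _ hs1)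
  have hpow : ((n : ℝ) ^ (3 - a)) ^ (-c₀) = (n : ℝ) ^ (-((3 - a) * c₀)) := by
    rw [← Real.rpow_mul hN0.le]; ring_nf
  rw [hpow] at hP
  have hnn : 0 ≤ (n : ℝ) ^ (-((3 - a) * c₀)) := Real.rpow_nonneg hN0.le _
  calc (n : ℝ) ^ a * μ.real {ω | (n : ℝ) ^ (3 - a) ≤
          (((box 3 (2 * n)).filter fun y => ω ∈ openConn 0 y).card : ℝ) ∧
          openCluster ω 0 ⊆ ↑(box 3 (2 * n))}
      ≤ (n : ℝ) ^ a * (max C 0 * (n : ℝ) ^ (-((3 - a) * c₀))) := by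
        refine mul_le_mul_of_nonneg_left (hP.trans ?_) (Real.rpow_nonneg hN0.le _)
        exact mul_le_mul_of_nonneg_right (le_max_left _ _) hnn
    _ = max C 0 * ((n : ℝ) ^ a * (n : ℝ) ^ (-((3 - a) * c₀))) := by ring
    _ = max C 0 * (n : ℝ) ^ (-e) := by
        rw [← Real.rpow_add hN0]; congr 1; rw [he_def]; ring_nf

end Summit.CriticalPhenomena.PercolationContinuityZ3.Cruxes.FreeBoxPowerSaving.BoundaryInteriorSplitFatFiniteClusters

end
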